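import Summits.QuantumFields.YangMills.Theorems.BalabanUVNodesK2V6Defs
import Mathlib.LinearAlgebra.UnitaryGroup
import Mathlib.Analysis.SpecialFunctions.Complex.Circle
import Mathlib.Data.ZMod.Basic

/-!
# Crux idea `two-route-twisted-laplace` on K2⁷ `EndpointGivenBR13SepCoPH` (stmt-QuantumFields-20543) — SKETCH (first lemmas, elaborated)

Cell `ym-nodeO-ideate`, IDEATOR seat `ym-nodeO-idea-1` gen 10.  HONEST FRAMING: the YM mass gap (Clay) is NOT proved by any of this;
route R4 `BalabanUVNodes` closes only the CONDITIONAL finite-𝕋⁴ rung `BalabanLadder.UV`; NODE O ([I] Thm 2 p. 259) is unproved in print;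
K2⁷ stays OPEN.  Every `def … : Prop` below is a HYPOTHESIS SHAPE (obligation text), never a fact; what is PROVED here is
real-number bookkeeping (§1–§2) and by-name composition with the tree letters (§3).  §4 TYPES the classical statement S1 of the card
(lattice Morse–Bott minimum on the doubly twisted symmetric SU(2) torus) as a `Prop`, unproved.

[I] = Bałaban, Commun. Math. Phys. 109 (1987) 249 (`paper:balaban1987-cmp109-rg-i-small-field`): (1.3) p. 261, (1.18)–(1.22) pp. 263–264,
(0.23) p. 256, (0.28)–(0.30) p. 258.  't Hooft, Nucl. Phys. B153 (1979) 141 (`book:hooft1994-under-spell-gauge-principle` pp. 364–372, twisted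
functional integrals `W{k,m}` (9.1)–(11.7)); 't Hooft, Commun. Math. Phys. 81 (1981) 267 (doi:10.1007/bf01208900; constant-curvature self-dual
solutions on the symmetric hypertorus, cited `paper:arxiv-2406.07636` p. 16–17, 19).

THE LEVER (card): read Bałaban's step-K β-function `β_K(g_0,…,g_{K−1})` as the DIFFERENCE of two finite-dimensional LAPLACE evaluations of ONE
number — the all-small-field 't Hooft flux ratio `R_K = Z^sf_K(n₁₂=n₃₄=1) / Z^sf_K(n₁₂=1)` of an auxiliary doubly-twisted SU(2) torus of `N₀` coarse
cells — once after K steps (Laplace on `N₀⁴`, large parameter `1/g_K²`) and once after K−1 steps (Laplace on `(L N₀)⁴`, parameter `1/g_{K−1}²`).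
The coupling enters at LEADING order through the classical action gap `ΔS = S(½-instanton) − 0 → π²` (lattice units of §4); the two c₁-terms differ by
the step-K Gaussian fluctuation determinant (Schur complement), whose marginal coefficient IS `β⁰_K`; the accumulated effective actions `E_K`,
`E_{K−1}` enter only through their values on constant-curvature ∕ flat backgrounds, where COMPLETE marginal subtraction ((1.20)–(1.22)) + analyticity
((1.18)) + hypercubic∕charge-conjugation symmetry leave `O(E₀ N₀⁻⁴)` (dimension-8) + `O(e^{−κ N₀})` (wrapping); the two Laplace remainders are
`O(C₂(N₀) g²)` with K-UNIFORM constants (fixed dimension, format C⁴-norms, Morse–Bott gap).  Net: the TWO-PARAMETER SQUEEZE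
`|β_K − β⁰_K| ≤ C₁ N₀⁻⁴ + C₂(N₀) γ₀²` along in-window runs (§2's hypothesis shape), whence the run-wise constant remainder with ANY cap (§2, proved)
and the remainder∕anchor part of the tree letter `RunRemAt` (§3, proved modulo the survivor-continuity letter (C), which this lever does not supply).
TRANSFER CAVEAT (card `Transfer:`): the record `T4Family`∕`datumOfRecord₁₃SepCoPH` is PERIODIC; the lever needs a twisted-bundle EDITION of the
record's format with the SAME `βfun` — hypothesis `H-tw` of the card, not typed here beyond §2's abstract letters.
-/

noncomputable section

namespace Summit.QuantumFields.YangMills.Cruxes.EndpointGivenBR13SepCoPH.TwoRouteTwistedLaplace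

open Literature.MathematicalPhysics.QuantumFieldTheory.Balaban1983to89
open Literature.MathematicalPhysics.QuantumFieldTheory.Balaban1983to89.FlowStep
open Literature.MathematicalPhysics.QuantumFieldTheory.Balaban1983to89.T4Continuum (T4Family)
open Summit.QuantumFields.YangMills.Theorems.BalabanUVNodesK2JsOfRecord (StepColourData beta0OfJs)
open Summit.QuantumFields.YangMills.Theorems.BalabanUVNodesK2NamedJetsRemAt (ScaleAnchor)
open Summit.QuantumFields.YangMills.Theorems.BalabanUVNodesK2NamedJetsRunRemAt (RunRemAt RunConstRemainder SurvCont)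
open Summit.QuantumFields.YangMills.Theorems.BalabanUVNodesK2V6Defs (Window13 RunRemAtSomeJets)

/-! ## §1 The two-route squeeze for ONE step (real-number bookkeeping, proved)

`βK·ΔS = D − δE + ρ₁ − ρ₂` is the identity "route 1 = route 2" for the log flux ratio after the classical terms are matched by (1.3):
`D` = difference of the two c₁-terms (Schur complement = step-K Gaussian determinant in the two backgrounds), `δE` = sector difference of the
accumulated effective actions at the two levels, `ρ₁, ρ₂` = the two finite-dimensional Laplace remainders. -/

/-- **TWO-ROUTE SQUEEZE, ONE STEP.**  If `βK·ΔS = D − δE + ρ₁ − ρ₂` with `ΔS > 0`, `|D − β0·ΔS| ≤ e₁` (one-loop determinant: marginal coefficient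
`β0`, irrelevant rest), `|δE| ≤ e₂` (complete marginal subtraction + analyticity), `|ρ₁| ≤ e₃`, `|ρ₂| ≤ e₄` (Laplace remainders), then
`|βK − β0| ≤ (e₁ + e₂ + e₃ + e₄) / ΔS`. [folklore] -/
theorem abs_sub_le_of_twoRoute {βK β0 ΔS D δE ρ₁ ρ₂ e₁ e₂ e₃ e₄ : ℝ} (hS : 0 < ΔS)
    (hid : βK * ΔS = D - δE + ρ₁ - ρ₂) (hD : |D - β0 * ΔS| ≤ e₁) (hE : |δE| ≤ e₂) (h₁ : |ρ₁| ≤ e₃) (h₂ : |ρ₂| ≤ e₄) :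
    |βK - β0| ≤ (e₁ + e₂ + e₃ + e₄) / ΔS := by
  rw [le_div_iff₀ hS]
  have hnum : |(βK - β0) * ΔS| ≤ e₁ + e₂ + e₃ + e₄ := by
    have e : (βK - β0) * ΔS = (D - β0 * ΔS) + (-δE) + ρ₁ + (-ρ₂) := by linear_combination hid
    rw [e]
    calc |(D - β0 * ΔS) + (-δE) + ρ₁ + (-ρ₂)|
        ≤ |(D - β0 * ΔS) + (-δE) + ρ₁| + |-ρ₂| := abs_add_le _ _
      _ ≤ |(D - β0 * ΔS) + (-δE)| + |ρ₁| + |-ρ₂| := by gcongr; exact abs_add_le _ _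
      _ ≤ |D - β0 * ΔS| + |-δE| + |ρ₁| + |-ρ₂| := by gcongr; exact abs_add_le _ _
      _ ≤ e₁ + e₂ + e₃ + e₄ := by rw [abs_neg, abs_neg]; linarith
  simpa [abs_mul, abs_of_pos hS] using hnum

/-! ## §2 The two-parameter squeeze along in-window runs ⟹ the run-wise constant remainder with ANY positive cap (proved)

HYPOTHESIS SHAPE `TwoParamSqueeze β b C₁ C₂ γ̄`: for every auxiliary size `N ≥ 1` and every level `0 < γ ≤ γ̄`, along every solution of (0.20) staying
in `]0, γ]`, `|β_k(g_0,…,g_k) − b_k| ≤ C₁/N⁴ + C₂(N)·γ²` at every prefix — what §1 gives step by step once `e₁ + e₂ ≤ C₁ ΔS/N⁴` (format, N-free `C₁`)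
and `e₃ + e₄ ≤ C₂(N) ΔS γ²` (Laplace, N-dependent `C₂`).  Never a fact. -/

/-- HYPOTHESIS SHAPE (never a fact): the two-parameter squeeze of `β` around `b` along in-window runs. [folklore] -/
def TwoParamSqueeze (β : HBeta) (b : ℕ → ℝ) (C₁ : ℝ) (C₂ : ℕ → ℝ) (γbar : ℝ) : Prop :=
  ∀ N : ℕ, 0 < N → ∀ γ : ℝ, 0 < γ → γ ≤ γbar →
    ∀ (n : ℕ) (gs : ℕ → ℝ), RGEqH n β gs → Step.InInterval γ n gs →
      ∀ k, k ≤ n → |β k (prefixOf gs k) - b k| ≤ C₁ / (N : ℝ) ^ 4 + C₂ N * γ ^ 2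

/-- **SQUEEZE ⟹ RUN-WISE CONSTANT REMAINDER WITH ANY CAP**: choose `N` with `C₁/N⁴ ≤ s/2`, then `γ ≤ min(γ̄, 1, s/(2(C₂(N)+1)))`. [folklore] -/
theorem runConstRemainder_of_twoParamSqueeze {β : HBeta} {b : ℕ → ℝ} {C₁ γbar : ℝ} {C₂ : ℕ → ℝ}
    (hγ : 0 < γbar) (hC₁ : 0 ≤ C₁) (hC₂ : ∀ N, 0 ≤ C₂ N) (h : TwoParamSqueeze β b C₁ C₂ γbar) {s : ℝ} (hs : 0 < s) :
    ∃ γ : ℝ, 0 < γ ∧ γ ≤ γbar ∧ RunConstRemainder β b s γ := by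
  -- choose the auxiliary size N
  obtain ⟨N₀, hN₀⟩ := exists_nat_gt (2 * C₁ / s)
  set N : ℕ := N₀ + 1 with hNdef
  have hNpos : 0 < N := Nat.succ_pos _
  have hN : 2 * C₁ / s < (N : ℝ) := hN₀.trans_le (by rw [hNdef]; push_cast; linarith)
  have hNr : (1 : ℝ) ≤ N := by exact_mod_cast hNpos
  have hNr0 : (0 : ℝ) < N := by linarith
  have hfirst : C₁ / (N : ℝ) ^ 4 ≤ s / 2 := by
    have h4 : (N : ℝ) ≤ (N : ℝ) ^ 4 := by
      calc (N : ℝ) = (N : ℝ) ^ 1 := (pow_one _).symm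
        _ ≤ (N : ℝ) ^ 4 := pow_le_pow_right₀ hNr (by norm_num)
    have hA : C₁ / (N : ℝ) ^ 4 ≤ C₁ / N := div_le_div_of_nonneg_left hC₁ hNr0 h4
    have hB : C₁ / (N : ℝ) ≤ s / 2 := by
      rw [div_le_iff₀ hNr0]
      have := (div_lt_iff₀ hs).mp hN
      linarith
    exact hA.trans hB
  -- choose the level γ
  set c : ℝ := C₂ N with hc
  have hc0 : 0 ≤ c := hC₂ N
  refine ⟨min γbar (min 1 (s / (2 * (c + 1)))), ?_, min_le_left _ _, ?_⟩
  · refine lt_min hγ (lt_min one_pos ?_); positivity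
  · intro n gs hrg hI k hk
    have hγ' : min γbar (min 1 (s / (2 * (c + 1)))) ≤ γbar := min_le_left _ _
    have hpos : 0 < min γbar (min 1 (s / (2 * (c + 1)))) := by
      refine lt_min hγ (lt_min one_pos ?_); positivity
    have hb := h N hNpos _ hpos hγ' n gs hrg hI k hk
    have hle1 : min γbar (min 1 (s / (2 * (c + 1)))) ≤ 1 := (min_le_right _ _).trans (min_le_left _ _)
    have hles : min γbar (min 1 (s / (2 * (c + 1)))) ≤ s / (2 * (c + 1)) := (min_le_right _ _).trans (min_le_right _ _)
    have hsq : (min γbar (min 1 (s / (2 * (c + 1))))) ^ 2 ≤ s / (2 * (c + 1)) := by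
      calc (min γbar (min 1 (s / (2 * (c + 1))))) ^ 2
          = min γbar (min 1 (s / (2 * (c + 1)))) * min γbar (min 1 (s / (2 * (c + 1)))) := sq _
        _ ≤ 1 * (s / (2 * (c + 1))) := by gcongr
        _ = s / (2 * (c + 1)) := one_mul _
    have hsecond : c * (min γbar (min 1 (s / (2 * (c + 1))))) ^ 2 ≤ s / 2 := by
      calc c * (min γbar (min 1 (s / (2 * (c + 1))))) ^ 2 ≤ c * (s / (2 * (c + 1))) := by gcongr
        _ ≤ (c + 1) * (s / (2 * (c + 1))) := by gcongr; linarith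
        _ = s / 2 := by field_simp
    calc |β k (prefixOf gs k) - b k| ≤ C₁ / (N : ℝ) ^ 4 + c * (min γbar (min 1 (s / (2 * (c + 1))))) ^ 2 := hb
      _ ≤ s / 2 + s / 2 := add_le_add hfirst hsecond
      _ = s := by ring

/-! ## §3 At NODE 00's Stage-13 record: squeeze + anchor + (C) ⟹ the run letter `RunRemAt F κ θ hP θ.cβ`, hence 2ᴮ″'s conclusion (proved, by name)

The squeeze is read for the record's `βfun` around the SCALED named one-loop numbers `θ.cβ · beta0OfJs F κ` (identification S5 of the card: these ARE the
marginal coefficients of the step Gaussian determinants — hypothesis, carried by `ScaleAnchor` exactly as the 1ᴬ ∕ N17 roads carry it).  (C) on the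
survivor sets is NOT supplied by the lever: hypothesis `hC` (road (D5) ∕ `SurvCont.of_betaContH`). -/

/-- HYPOTHESIS SHAPE (never a fact): **THE TWO-PARAMETER SQUEEZE AT THE RECORD**, κ and the constants chosen after `θ`. [folklore] -/
def SqueezeAtRecord (F : T4Family) (κ : StepColourData) (θ : Node00.Stage13HParams F 2) (hP : θ.Provisos₁₃SepCoPH F 2) : Prop :=
  ∃ (C₁ γbar : ℝ) (C₂ : ℕ → ℝ), 0 ≤ C₁ ∧ (∀ N, 0 ≤ C₂ N) ∧ 0 < γbar ∧ γbar ≤ θ.γ ∧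
    TwoParamSqueeze (Node00.datumOfRecord₁₃SepCoPH F 2 θ hP).βfun (fun k => θ.cβ * beta0OfJs F κ k) C₁ C₂ γbar

/-- **SQUEEZE + ANCHOR + (C) ⟹ `RunRemAt F κ θ hP θ.cβ`** (the run letter p596574 :175, with the cap `s := θ.cβ · stepBal 2 F.L` itself). [folklore] -/
theorem runRemAt_of_squeeze (F : T4Family) (κ : StepColourData) (θ : Node00.Stage13HParams F 2) (hP : θ.Provisos₁₃SepCoPH F 2)
    (hcap : 0 < θ.cβ * B12Normalization.stepBal 2 F.L)
    (hsq : SqueezeAtRecord F κ θ hP)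
    (hanch : ScaleAnchor (Node00.datumOfRecord₁₃SepCoPH F 2 θ hP).βfun (fun k => θ.cβ * beta0OfJs F κ k))
    (hC : ∀ γ : ℝ, 0 < γ → γ ≤ θ.γ → SurvCont (Node00.datumOfRecord₁₃SepCoPH F 2 θ hP).βfun γ) :
    RunRemAt F κ θ hP θ.cβ := by
  obtain ⟨C₁, γbar, C₂, hC₁, hC₂, hγ, hγθ, h⟩ := hsq
  obtain ⟨γ, hγ0, hγle, hrem⟩ := runConstRemainder_of_twoParamSqueeze hγ hC₁ hC₂ h hcap
  exact ⟨γ, θ.cβ * B12Normalization.stepBal 2 F.L, hγ0, hγle.trans hγθ, le_rfl, hrem, hanch, hC γ hγ0 (hγle.trans hγθ)⟩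

/-- HYPOTHESIS SHAPE (never a fact): **WHAT THE PHYSICS STUBS S1–S5 + H-tw OF THE CARD MUST DELIVER AT A TUPLE CARRYING THE CRUX'S HYPOTHESES** —
some colour datum κ (chosen AFTER θ) with the squeeze, the anchor, and (C) below `θ.γ`, plus the positivity of the cap. [folklore] -/
def SqueezeSomeJets : Prop :=
  ∀ (F : T4Family) (θ : Node00.Stage13HParams F 2) (hP : θ.Provisos₁₃SepCoPH F 2), (θ.ZhUnity F 2 ∧ θ.SlotsNondegenerate₁₃ F 2) → θ.Admissible F 2 →
    B16.EndStatementBPrinted (Node00.datumOfRecord₁₃SepCoPH F 2 θ hP).C → Window13 F θ hP →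
    0 < θ.cβ * B12Normalization.stepBal 2 F.L ∧
    ∃ κ : StepColourData, SqueezeAtRecord F κ θ hP ∧
      ScaleAnchor (Node00.datumOfRecord₁₃SepCoPH F 2 θ hP).βfun (fun k => θ.cβ * beta0OfJs F κ k) ∧
      ∀ γ : ℝ, 0 < γ → γ ≤ θ.γ → SurvCont (Node00.datumOfRecord₁₃SepCoPH F 2 θ hP).βfun γ

/-- **★ THE LINE'S JUNCTION WITH THE REGISTERED STUB TEXT 2ᴮ″ (`stub_runRemNamedJets13 : RunRemAtSomeJets`, v6)**: `SqueezeSomeJets → RunRemAtSomeJets`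
(tree def p603331∕p606356), kernel-checked; with 1ᴬ the crux follows BY NAME via `EndpointGivenBR13SepCoPH_of_stubTexts`. [folklore] -/
theorem runRemAtSomeJets_of_squeezeSomeJets (h : SqueezeSomeJets) : RunRemAtSomeJets := by
  intro F θ hP hU hθ hB hwin
  obtain ⟨hcap, κ, hsq, hanch, hC⟩ := h F θ hP hU hθ hB hwin
  exact ⟨κ, runRemAt_of_squeeze F κ θ hP hcap hsq hanch hC⟩

/-- The composition to the crux decl BY NAME (conditional on 1ᴬ's text and the squeeze package; nothing of Bałaban asserted). [folklore] -/
theorem EndpointGivenBR13SepCoPH_of_squeeze (h₁ : Summit.QuantumFields.YangMills.Theorems.BalabanUVNodesK2V6Defs.D1AtAnchoredJets)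
    (h₂ : SqueezeSomeJets) : Summit.QuantumFields.YangMills.Theses.BalabanUVNodes.EndpointGivenBR13SepCoPH :=
  Summit.QuantumFields.YangMills.Theorems.BalabanUVNodesK2V6Defs.EndpointGivenBR13SepCoPH_of_stubTexts h₁
    (runRemAtSomeJets_of_squeezeSomeJets h₂)

end Summit.QuantumFields.YangMills.Cruxes.EndpointGivenBR13SepCoPH.TwoRouteTwistedLaplace

/-! ## §4 The classical statement S1, TYPED (unproved `Prop`): Morse–Bott minimum of the doubly-twisted SU(2) Wilson action on the symmetric lattice torus

Sites `Fin 4 → ZMod N`, links in `SU(2) = Matrix.specialUnitaryGroup (Fin 2) ℂ`, twist `n₀₁ = n₂₃ = 1` implemented by flipping the sign of the plaquettes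
`P₀₁(x)` with `x₀ = x₁ = 0` and `P₂₃(x)` with `x₂ = x₃ = 0` ('t Hooft 1979; lattice form as in `paper:arxiv-2406.07636` §2.1).  Plaquette density
`1 − ½ ω Re tr U_P`; for `U_P = exp(iφσ₃)` it is `1 − cos φ`.  S1 says: within the ε-admissible class and for `N ≥ N₁`, the minimum value is within `C/N⁴`
of `π²` (uniform abelian flux `φ = π/N²` in the two twisted planes: `2·N⁴·(1 − cos(π/N²)) = π² − O(N⁻⁴)`), and every admissible minimiser has, after a
gauge transformation, ALL physical plaquettes equal to the uniform abelian values (so the minimising set is the 4-torus of constant holonomies = the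
lattice shadow of 't Hooft's moduli).  Transversal nondegeneracy (the Morse–Bott gap) is stated informally in the card (S1b); not typed here. -/

namespace Summit.QuantumFields.YangMills.Cruxes.EndpointGivenBR13SepCoPH.TwoRouteTwistedLaplace.Classical

open Matrix Complex

variable (N : ℕ) [NeZero N]

/-- Lattice sites of the symmetric 4-torus of side `N`. -/
abbrev Site : Type := Fin 4 → ZMod N

/-- SU(2) link variables. -/
abbrev SU2 : Type := Matrix.specialUnitaryGroup (Fin 2) ℂ

/-- A lattice gauge field: one SU(2) matrix per (site, direction). -/
abbrev GaugeField : Type := Site N → Fin 4 → SU2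

/-- Unit step in direction `μ`. -/
def step (μ : Fin 4) : Site N := Pi.single μ 1

/-- The plaquette matrix `U_μ(x) U_ν(x+μ) U_μ(x+ν)⁻¹ U_ν(x)⁻¹`, as a complex 2×2 matrix. -/
def plaq (U : GaugeField N) (x : Site N) (μ ν : Fin 4) : Matrix (Fin 2) (Fin 2) ℂ :=
  ((U x μ * U (x + step N μ) ν * (U (x + step N ν) μ)⁻¹ * (U x ν)⁻¹ : SU2) : Matrix (Fin 2) (Fin 2) ℂ)

/-- The doubly-twisted sign table `ω`: `−1` on the plaquette stack `P₀₁(x), x₀ = x₁ = 0` and on `P₂₃(x), x₂ = x₃ = 0`, else `+1` (twist `n₀₁ = n₂₃ = 1`). -/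
def twistSign (x : Site N) (μ ν : Fin 4) : ℝ :=
  if (μ = 0 ∧ ν = 1 ∧ x 0 = 0 ∧ x 1 = 0) ∨ (μ = 2 ∧ ν = 3 ∧ x 2 = 0 ∧ x 3 = 0) then -1 else 1

/-- Plaquette action density `1 − ½ ω Re tr U_P` (for `μ < ν`). -/
def plaqDensity (U : GaugeField N) (x : Site N) (μ ν : Fin 4) : ℝ :=
  1 - twistSign N x μ ν * ((Matrix.trace (plaq N U x μ ν)).re / 2)

/-- The doubly-twisted Wilson action `S(U) = Σ_x Σ_{μ<ν} (1 − ½ ω Re tr U_P)`. -/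
def wilsonTw (U : GaugeField N) : ℝ :=
  ∑ x : Site N, ∑ μ : Fin 4, ∑ ν : Fin 4, if μ < ν then plaqDensity N U x μ ν else 0

/-- The ε-admissible (all-small-field) class: every plaquette density is `≤ ε`. -/
def Admissible (ε : ℝ) (U : GaugeField N) : Prop :=
  ∀ (x : Site N) (μ ν : Fin 4), μ < ν → plaqDensity N U x μ ν ≤ ε

/-- Gauge transformation `(g·U)_μ(x) = g(x) U_μ(x) g(x+μ)⁻¹`. -/
def gaugeAct (g : Site N → SU2) (U : GaugeField N) : GaugeField N :=
  fun x μ => g x * U x μ * (g (x + step N μ))⁻¹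

/-- The uniform abelian plaquette value `diag(e^{iφ}, e^{−iφ})`. -/
def diagPhase (φ : ℝ) : Matrix (Fin 2) (Fin 2) ℂ :=
  Matrix.diagonal ![Complex.exp (Complex.I * φ), Complex.exp (-(Complex.I * φ))]

/-- "All PHYSICAL plaquettes of `U` are the uniform abelian ones": `ω·U_P = diag(e^{±iπ/N²})` in the two twisted planes, `U_P = 1` in the other four. -/
def UniformFlux (U : GaugeField N) : Prop :=
  ∀ x : Site N,
    (twistSign N x 0 1 : ℂ) • plaq N U x 0 1 = diagPhase (Real.pi / (N : ℝ) ^ 2) ∧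
    (twistSign N x 2 3 : ℂ) • plaq N U x 2 3 = diagPhase (Real.pi / (N : ℝ) ^ 2) ∧
    plaq N U x 0 2 = 1 ∧ plaq N U x 0 3 = 1 ∧ plaq N U x 1 2 = 1 ∧ plaq N U x 1 3 = 1

/-- **S1 (value + minimisers), TYPED, UNPROVED**: for some admissibility threshold `ε₀ > 0`, constant `C` and all large `N`, the doubly-twisted Wilson
action restricted to the ε₀-admissible class attains its minimum, the minimum is within `C/N⁴` of `π²`, and every admissible minimiser is uniform
abelian flux up to gauge (minimising set = the 4-torus of constant holonomies).  HYPOTHESIS SHAPE of the card's stub S1a; never a fact. -/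
def S1MinimumStatement : Prop :=
  ∃ ε₀ C : ℝ, 0 < ε₀ ∧ ∃ N₁ : ℕ, ∀ (N : ℕ) [NeZero N], N₁ ≤ N →
    ∃ Smin : ℝ, |Smin - Real.pi ^ 2| ≤ C / (N : ℝ) ^ 4 ∧
      (∀ U : GaugeField N, Admissible N ε₀ U → Smin ≤ wilsonTw N U) ∧
      (∃ U : GaugeField N, Admissible N ε₀ U ∧ wilsonTw N U = Smin ∧ UniformFlux N U) ∧
      (∀ U : GaugeField N, Admissible N ε₀ U → wilsonTw N U = Smin → ∃ g : Site N → SU2, UniformFlux N (gaugeAct N g U))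

end Summit.QuantumFields.YangMills.Cruxes.EndpointGivenBR13SepCoPH.TwoRouteTwistedLaplace.Classical
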